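import Summits.BirchSwinnertonDyer.BirchSwinnertonDyer.Theorems.PrintX11aUpperNonSurjThreeEngineWithoutGZK
import HarnessLib

/-!
# Route `PrintX11a`, crux U3 `UpperNonSurjThree` (item stmt-BirchSwinnertonDyer-20613): U3 in the honest `3`-PRIMARY
# currency — LEMMA FILE (§1: the two rank-`0` leading-term lemmas with `#Ш[p^∞] < ∞` exported); the engine and the class-wide
# display are `PrintX11aUpperNonSurjThreePrimaryBound.lean` (kept apart for the 400-line rule)

Cell `bsd-print-x11a`, width seat `bsd-line-x11a-p2` g4 of line «finemu3» (`--supports stmt-BirchSwinnertonDyer-20613 --as helper`).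
Theorems only; Theses-free; CONDITIONAL on the named facts displayed as hypotheses; BSD is not proved by any of this; nothing is
asserted about any curve; item 20613 does not close by this file.

THE POINT (referee V49's typing note, 2026-08-28).  The typed conclusion of U3, `Typed.MissingUpperBoundAt W 3`, reads `#Ш` as
`W.shaOrder = Nat.card Ш(E/ℚ)`, which is the junk value `0` when `Ш` is infinite; the nine-fact road (g3,
`ClassX11a.upperNonSurjThree_body_of_nineFacts`) does not read Gross–Zagier–Kolyvagin, so inside its proof nothing knows that `Ш`
is finite, and on an infinite `Ш` the typed inequality holds as `ord₃ 0 = 0 ≤ …`.  The MATHEMATICALLY MEANINGFUL content the same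
proof produces is the `3`-primary statement, which needs no finiteness of `Ш` beyond `Ш[3^∞]` and which this file DISPLAYS class-wide:
at every X11a pair `(W, 3)` with `ρ̄_{E,3}` not surjective (`r_an = 0`, `3 ∥ N`, `E[3]` irreducible, images `3Ns ∕ 3Nn`),
* `rank E(ℚ) = 0` (Kato's divisibility + the tree's control theorem `mordellWeilRank_le_order_of_mem_charIdeal`),
* `Ш(E/ℚ)[3^∞]` is FINITE (Stein–Wuthrich 6.1 clause 2 at `ord_T f_E = 0 = rank`), and
* `ord₃ #Ш(E/ℚ)[3^∞] ≤ ord₃ #Ш(E)_an`, `#Ш(E)_an = (L(E,1)/Ω_E) · #E(ℚ)² / ∏_ℓ c_ℓ` (Miller's rational number; `Reg = 1`),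
granted the nine facts — Stein–Wuthrich 6.1 ×2, Greenberg–Stevens ∕ Kobayashi AT A SPLIT `3` ONLY, Kato 12.4, modularity, Kato
§17.13 V′ ∕ VI′ ∕ XI′ (contragredient packages), Mazur Cor. 4.1.  When `Ш(E/ℚ)` is finite this is literally `ord₃ #Ш ≤ ord₃ #Ш_an`
(`#Ш` and `#Ш[3^∞]` differ by a `3`-adic unit); when it is not, it is still the `3`-part of the BSD upper bound, not a junk `0 ≤ …`.

HOW.  §1 re-runs g3's two rank-`0` leading-term lemmas (`X11b.le_padicValRat_of_{nonsplit,split}_divisibility_rankZero_noGZK`,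
file `PrintX11aUpperNonSurjThreeRankZeroNoGZK.lean`) with the STRONGER conclusion `rank = 0 ∧ #Ш[p^∞] < ∞ ∧ (p-primary
inequality)` — same proof, last line through `padicValNat_card_primary_le_of_torsionSq_mul_eq` instead of the `shaOrder`
bookkeeping (the originals are append-only and do not export `#Ш[p^∞] < ∞`); §2 packages the inequality against Miller's `#Ш_an`
(`shaAn W`); §3 is the engine `X11b.MultDivisibilityAt W p ⟹ primary bound` at any odd multiplicative `p` with `r_an = 0`
(p-generic: usable verbatim by U5 ∕ the K2 corner); §4 is the class-wide display at `p = 3` from the nine facts with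
Greenberg–Stevens keyed at a split `3` ∕ at odd primes (the printed scope, cf. `upperNonSurjThree_of_nineFacts_oddGS`).
beyond-print theorem: no (the `μ₃` input is width seat g2's theorem `MultThreeMuAn.muAnZeroAt_three_of_mult_of_irr`, as before).

References (locators only): [cite: SteinWuthrich2013, Thm. 6.1 (p. 20), §4.2] [cite: BalakrishnanMullerStein2015, Thm. 1.7]
[cite: GreenbergLNM1716, Lemma 3.1, §4] [cite: Kobayashi2006DocMath, Cor. 4.2 (p. 575)] [cite: Miller2011LMS, Def. 1.1 and §1]
[cite: Kato2004Asterisque, Thm. 12.4 (p. 221), §17.13 (pp. 279–280)] [cite: Mazur1978, Cor. 4.1]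
[cite: MazurTateTeitelbaum1986Invent, §I.14–I.15]; tree `PrintX11aUpperNonSurjThree{RankZeroNoGZK,EngineWithoutGZK,Corollary18OfMazur}.lean`.
-/

set_option autoImplicit false

noncomputable section

open scoped Classical MatrixGroups ModularForm

open CongruenceSubgroup WeierstrassCurve
  Literature.NumberTheory.EllipticCurves
  Literature.NumberTheory.EllipticCurves.ModularForms
  Literature.NumberTheory.EllipticCurves.Rank1Residual
  Literature.NumberTheory.EllipticCurves.Rank1Residual.Typed
  Literature.NumberTheory.EllipticCurves.Wuthrich2014
  Literature.NumberTheory.EllipticCurves.SteinWuthrich2013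
  Literature.NumberTheory.EllipticCurves.Greenberg1999
  Literature.NumberTheory.EllipticCurves.Kato2004
  Summit.BirchSwinnertonDyer.Rank1Residual
  Summit.BirchSwinnertonDyer.Rank1Residual.RankZeroHeightFree
  Summit.BirchSwinnertonDyer.BirchSwinnertonDyer.Theorems

namespace Summit.BirchSwinnertonDyer.Rank1Residual.X11b

/-! ### §1 The two rank-`0` leading-term lemmas with the `p`-PRIMARY conclusion (`#Ш[p^∞] < ∞` exported) -/

/-- **Rank `0`, NON-SPLIT multiplicative `p ≠ 2`: `rank E(ℚ) = 0`, `#Ш[p^∞] < ∞` and the `p`-primary inequality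
`ord_p #Ш[p^∞] + ord_p ∏ c_v − 2 ord_p #E(ℚ)_tors ≤ ord_p (L(E,1)/Ω_E)` from the ONE-SIDED divisibility `∃ h ∈ char_Λ X, ι h = ϖ·L`**
— the proof of `le_padicValRat_of_nonsplit_divisibility_rankZero_noGZK` (g3) verbatim (control theorem ⟹ rank `0`; the zero height
datum; Stein–Wuthrich 6.1 clauses 2–3), closed by `padicValNat_card_primary_le_of_torsionSq_mul_eq` instead of the `shaOrder`
bookkeeping; `Ш` itself may be infinite. [cite: SteinWuthrich2013, Thm. 6.1 (p. 20) and §4.2] [cite: BalakrishnanMullerStein2015, Thm. 1.7]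
[cite: GreenbergLNM1716, Lemma 3.1 and §4] [cite: Miller2011LMS, §1] -/
theorem primaryBound_of_nonsplit_divisibility_rankZero (hJ : thm61_nonsplitMultiplicative)
    (W : WeierstrassCurve ℚ) [W.IsElliptic] [W.IsGloballyMinimal] (p : ℕ) [Fact p.Prime]
    {κ : ZpExtension ℚ p} {γ : Field.absoluteGaloisGroup ℚ} {N : ℕ} [NeZero N]
    {f : CuspForm (Gamma0 N) 2} (hp : p ≠ 2) (hL1 : W.entireLFunction 1 ≠ 0)
    (hmult : W.HasMultiplicativeReductionAtPrime p)
    (hns : ¬ W.HasSplitMultiplicativeReductionAtPrime p)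
    {q : ℚ_[p]} (hq0 : q ≠ 0) (hq1 : ‖q‖ < 1) (hqj : tateJ q = (W.j : ℚ_[p]))
    (hκ : κ.IsCyclotomic) (hγ : κ.IsTopGenerator γ) (hγ' : IsCyclotomicVariable p γ)
    (hf : IsNewformOf W f) (D : W.SelmerDualData κ γ) (ϖ : ℚ) (hϖ0 : ϖ ≠ 0)
    (hϖ : (ϖ : ℝ) * W.realPeriodRat = plusPeriod f)
    (L : PowerSeries ℚ_[p]) (hL : IsMultPAdicLFunctionOf f p (-1) L) (hX : D.IsTorsion)
    (hdiv : ∃ h ∈ D.charIdeal, iwasawaToPowerSeries p h = PowerSeries.C ((ϖ : ℚ) : ℚ_[p]) * L) :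
    W.mordellWeilRank = 0 ∧ Finite (AddCommGroup.primaryComponent W.sha p) ∧
    ∃ t : ℚ, W.entireLFunction 1 / (W.realPeriodRat : ℂ) = (t : ℂ) ∧
      (padicValNat p (Nat.card (AddCommGroup.primaryComponent W.sha p)) : ℤ) + padicValNat p W.tamagawaProduct -
        2 * padicValNat p W.torsionOrder ≤ padicValRat p t := by
  have hpP : p.Prime := Fact.out
  haveI : Module.Finite (IwasawaAlgebra p) D.X := D.module_finite_holds hγ
  obtain ⟨h, hh, hι⟩ := hdiv
  -- the control theorem: `rank E(ℚ) ≤ ord_T h`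
  have hrk : (W.mordellWeilRank : ℕ∞) ≤ h.order := W.mordellWeilRank_le_order_of_mem_charIdeal hγ D hX hh
  -- a generator of the (principal) characteristic ideal, and the cofactor `k` with `k·g = h`
  obtain ⟨g, hg⟩ := (charIdeal_isPrincipal_holds p D.X).principal
  have hchar : D.charIdeal = Ideal.span {g} := hg
  rw [hchar] at hh
  obtain ⟨k, hkg⟩ := Ideal.mem_span_singleton'.mp hh
  -- the rational `t = ϖ · [0]⁺_f = L(E,1)/Ω_E`
  set s : ℚ := ratPlusSymbol f 0 with hs_def
  set t : ℚ := ϖ * s with ht_def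
  have hΩpos : 0 < W.realPeriodRat := W.realPeriodRat_pos_holds
  have hLval : W.entireLFunction 1 = (((s : ℝ) * plusPeriod f : ℝ) : ℂ) := hf.entireLFunction_one_eq
  have hq : W.entireLFunction 1 / (W.realPeriodRat : ℂ) = ((t : ℚ) : ℂ) := by
    rw [hLval, ← hϖ, div_eq_iff (Complex.ofReal_ne_zero.mpr hΩpos.ne'), ht_def]
    push_cast
    ring
  have hs0 : s ≠ 0 := by
    intro h0
    apply hL1
    rw [hLval, h0]
    simp
  have ht0 : t ≠ 0 := mul_ne_zero hϖ0 hs0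
  -- constant coefficients of `ι(k · g) = ϖ · L`: `k(0) · g(0) = ϖ · 2 [0]⁺_f`
  have hL0 : PowerSeries.constantCoeff L = 2 * (s : ℚ_[p]) := hL.constantCoeff_of_neg_one
  have hkg' : PowerSeries.constantCoeff (k * g) =
      PowerSeries.constantCoeff k * PowerSeries.constantCoeff g := map_mul _ _ _
  have h0 := congrArg PowerSeries.constantCoeff hι
  rw [← hkg, constantCoeff_iwasawaToPowerSeries, hkg', PadicInt.coe_mul, map_mul,
    PowerSeries.constantCoeff_C, hL0] at h0
  -- `h(0) ≠ 0`, hence `ord_T h = 0` and `rank E(ℚ) = 0`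
  have hrhs0 : ((ϖ : ℚ) : ℚ_[p]) * (2 * (s : ℚ_[p])) ≠ 0 := by
    have hϖQ : ((ϖ : ℚ) : ℚ_[p]) ≠ 0 := by exact_mod_cast hϖ0
    have hsQ : ((s : ℚ) : ℚ_[p]) ≠ 0 := by exact_mod_cast hs0
    exact mul_ne_zero hϖQ (mul_ne_zero two_ne_zero hsQ)
  have hg0 : PowerSeries.constantCoeff g ≠ 0 := by
    intro hz
    apply hrhs0
    rw [← h0, hz, PadicInt.coe_zero, mul_zero]
  have hh0 : PowerSeries.constantCoeff h ≠ 0 := by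
    rw [← hkg, hkg']
    intro hz
    apply hrhs0
    rw [← h0]
    have : ((PowerSeries.constantCoeff k * PowerSeries.constantCoeff g : ℤ_[p]) : ℚ_[p]) = 0 := by
      rw [hz, PadicInt.coe_zero]
    rw [← PadicInt.coe_mul, this]
  have hr0 : W.mordellWeilRank = 0 := by
    have hord : h.order ≤ 0 := PowerSeries.order_le 0 (by rwa [PowerSeries.coeff_zero_eq_constantCoeff])
    have h0' : (W.mordellWeilRank : ℕ∞) = 0 := nonpos_iff_eq_zero.mp (hrk.trans hord)
    exact_mod_cast h0'
  haveI : Finite W.toAffine.Point := W.mordellWeilRank_eq_zero_iff_finite.mp hr0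
  -- THE height datum IS the zero pairing in rank `0`; `Reg_p = 1`
  obtain ⟨Dh, hDh⟩ := exists_isMultCanonical_of_finite W p q
  have hReg : padicRegulator Dh = 1 := padicRegulator_eq_one_of_finite W p Dh
  have hSch : SchneiderConjecture Dh := by
    rw [SchneiderConjecture, hReg]
    exact one_ne_zero
  -- Stein–Wuthrich Thm. 6.1: clause 2 gives `#Ш[p^∞] < ∞` at `ord_T f_E = 0 = rank`, then clause 3 in rank `0`
  obtain ⟨-, h2, h3⟩ := hJ W p hp hmult hns q hq0 hq1 hqj κ γ hκ hγ hγ' D hX g hchar Dh hDh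
  have hgord : g.order = (W.mordellWeilRank : ℕ∞) := by
    rw [hr0, Nat.cast_zero]
    exact nonpos_iff_eq_zero.mp (PowerSeries.order_le 0 (by rwa [PowerSeries.coeff_zero_eq_constantCoeff]))
  haveI hfinp : Finite (AddCommGroup.primaryComponent W.sha p) := (h2.mp hgord).2
  obtain ⟨u, hu⟩ := h3 hSch hfinp
  simp only [hr0, pow_zero, mul_one, hReg, PowerSeries.coeff_zero_eq_constantCoeff] at hu
  -- the cofactor's constant term is a `p`-adic INTEGER (not necessarily a unit)
  set k0 : ℚ_[p] := ((PowerSeries.constantCoeff k : ℤ_[p]) : ℚ_[p]) with hk0_def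
  have hk0v : 0 ≤ k0.valuation := PadicInt.valuation_coe_nonneg
  have htcast : ((t : ℚ) : ℚ_[p]) = (ϖ : ℚ_[p]) * (s : ℚ_[p]) := by
    rw [ht_def]; push_cast; ring
  -- the identity `t · #tors² = (u · k0) · #Ш[p^∞] · ∏ c_v`
  have key : (t : ℚ_[p]) * (W.torsionOrder : ℚ_[p]) ^ 2 =
      (((u : ℤ_[p]) : ℚ_[p]) * k0) *
        (Nat.card (AddCommGroup.primaryComponent W.sha p) : ℚ_[p]) * (W.tamagawaProduct : ℚ_[p]) := by
    apply mul_left_cancel₀ (two_ne_zero : (2 : ℚ_[p]) ≠ 0)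
    rw [htcast, hk0_def]
    linear_combination ((PowerSeries.constantCoeff k : ℤ_[p]) : ℚ_[p]) * hu -
      (W.torsionOrder : ℚ_[p]) ^ 2 * h0
  have hv : 0 ≤ (((u : ℤ_[p]) : ℚ_[p]) * k0).valuation := by
    by_cases hk : k0 = 0
    · rw [hk, mul_zero, Padic.valuation_zero]
    · rw [Padic.valuation_mul (coe_units_ne_zero p u) hk, valuation_coe_units_eq_zero, zero_add]
      exact hk0v
  exact ⟨hr0, hfinp, t, hq, padicValNat_card_primary_le_of_torsionSq_mul_eq W p ht0 _ hv key⟩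

/-- **Rank `0`, SPLIT multiplicative `p ≠ 2`: `rank E(ℚ) = 0`, `#Ш[p^∞] < ∞` and the `p`-primary inequality from the ONE-SIDED
divisibility `∃ h ∈ char_Λ X, ι(T·h) = ϖ·L`**, Greenberg–Stevens at the pair and `𝓛_p ≠ 0` — the proof of
`le_padicValRat_of_split_divisibility_rankZero_noGZK` (g3) verbatim, closed by `padicValNat_card_primary_le_of_torsionSq_mul_eq`.
[cite: SteinWuthrich2013, Thm. 6.1 (p. 20) and §4.2] [cite: Kobayashi2006DocMath, Cor. 4.2 (p. 575)]
[cite: BalakrishnanMullerStein2015, Thm. 1.7] [cite: MazurTateTeitelbaum1986Invent, §I.14–I.15] -/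
theorem primaryBound_of_split_divisibility_rankZero (hJ : thm61_splitMultiplicative)
    (W : WeierstrassCurve ℚ) [W.IsElliptic] [W.IsGloballyMinimal] (p : ℕ) [Fact p.Prime]
    (hGS : greenberg_stevens (W := W) (p := p)) (h𝓛 : LInvariant_ne_zero (W := W) (p := p))
    {κ : ZpExtension ℚ p} {γ : Field.absoluteGaloisGroup ℚ} {N : ℕ} [NeZero N]
    {f : CuspForm (Gamma0 N) 2} (hp : p ≠ 2) (hL1 : W.entireLFunction 1 ≠ 0)
    (Dq : TateParameterData W p)
    (hκ : κ.IsCyclotomic) (hγ : κ.IsTopGenerator γ) (hγ' : IsCyclotomicVariable p γ)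
    (hf : IsNewformOf W f) (D : W.SelmerDualData κ γ) (ϖ : ℚ) (hϖ0 : ϖ ≠ 0)
    (hϖ : (ϖ : ℝ) * W.realPeriodRat = plusPeriod f)
    (L : PowerSeries ℚ_[p]) (hL : IsSplitMultPAdicLFunctionOf f p L) (hX : D.IsTorsion)
    (hdiv : ∃ h ∈ D.charIdeal,
      iwasawaToPowerSeries p ((PowerSeries.X : IwasawaAlgebra p) * h) = PowerSeries.C ((ϖ : ℚ) : ℚ_[p]) * L) :
    W.mordellWeilRank = 0 ∧ Finite (AddCommGroup.primaryComponent W.sha p) ∧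
    ∃ t : ℚ, W.entireLFunction 1 / (W.realPeriodRat : ℂ) = (t : ℂ) ∧
      (padicValNat p (Nat.card (AddCommGroup.primaryComponent W.sha p)) : ℤ) + padicValNat p W.tamagawaProduct -
        2 * padicValNat p W.torsionOrder ≤ padicValRat p t := by
  have hpP : p.Prime := Fact.out
  haveI : Module.Finite (IwasawaAlgebra p) D.X := D.module_finite_holds hγ
  obtain ⟨h, hh, hι⟩ := hdiv
  have hrk : (W.mordellWeilRank : ℕ∞) ≤ h.order := W.mordellWeilRank_le_order_of_mem_charIdeal hγ D hX hh
  obtain ⟨g, hg⟩ := (charIdeal_isPrincipal_holds p D.X).principal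
  have hchar : D.charIdeal = Ideal.span {g} := hg
  rw [hchar] at hh
  obtain ⟨k, hkg⟩ := Ideal.mem_span_singleton'.mp hh
  set s : ℚ := ratPlusSymbol f 0 with hs_def
  set t : ℚ := ϖ * s with ht_def
  have hΩpos : 0 < W.realPeriodRat := W.realPeriodRat_pos_holds
  have hLval : W.entireLFunction 1 = (((s : ℝ) * plusPeriod f : ℝ) : ℂ) := hf.entireLFunction_one_eq
  have hq : W.entireLFunction 1 / (W.realPeriodRat : ℂ) = ((t : ℚ) : ℂ) := by
    rw [hLval, ← hϖ, div_eq_iff (Complex.ofReal_ne_zero.mpr hΩpos.ne'), ht_def]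
    push_cast
    ring
  have hs0 : s ≠ 0 := by
    intro h0
    apply hL1
    rw [hLval, h0]
    simp
  have ht0 : t ≠ 0 := mul_ne_zero hϖ0 hs0
  -- Greenberg–Stevens: `[T¹]L · log = 𝓛 · [0]⁺_f`
  obtain ⟨-, hGS1⟩ := hGS Dq hf hL
  -- `[T¹] ι(T·k·g) = k(0)·g(0)`
  have hkg' : PowerSeries.constantCoeff (k * g) =
      PowerSeries.constantCoeff k * PowerSeries.constantCoeff g := map_mul _ _ _
  have h1 : ((PowerSeries.constantCoeff k : ℤ_[p]) : ℚ_[p]) *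
      ((PowerSeries.constantCoeff g : ℤ_[p]) : ℚ_[p]) =
        ((ϖ : ℚ) : ℚ_[p]) * PowerSeries.coeff 1 L := by
    have h := congrArg (PowerSeries.coeff 1) hι
    rw [← hkg] at h
    rw [iwasawaToPowerSeries, PowerSeries.coeff_map, PowerSeries.coeff_succ_X_mul,
      PowerSeries.coeff_zero_eq_constantCoeff, hkg', PowerSeries.coeff_C_mul, map_mul] at h
    exact h
  have h𝓛0 : LInvariant Dq ≠ 0 := h𝓛 Dq
  -- `h(0) ≠ 0`: `k(0)·g(0)·log κ(γ) = ϖ·𝓛·[0]⁺_f ≠ 0`; hence `rank E(ℚ) = 0`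
  have hprod : ((PowerSeries.constantCoeff k : ℤ_[p]) : ℚ_[p]) * ((PowerSeries.constantCoeff g : ℤ_[p]) : ℚ_[p]) *
      padicLog p (cyclotomicGenerator p) = ((ϖ : ℚ) : ℚ_[p]) * (LInvariant Dq * (s : ℚ_[p])) := by
    rw [h1, mul_assoc, hGS1]
  have hrhs0 : ((ϖ : ℚ) : ℚ_[p]) * (LInvariant Dq * (s : ℚ_[p])) ≠ 0 := by
    have hϖQ : ((ϖ : ℚ) : ℚ_[p]) ≠ 0 := by exact_mod_cast hϖ0
    have hsQ : ((s : ℚ) : ℚ_[p]) ≠ 0 := by exact_mod_cast hs0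
    exact mul_ne_zero hϖQ (mul_ne_zero h𝓛0 hsQ)
  have hkg0 : ((PowerSeries.constantCoeff k : ℤ_[p]) : ℚ_[p]) * ((PowerSeries.constantCoeff g : ℤ_[p]) : ℚ_[p]) ≠ 0 := by
    intro hz
    apply hrhs0
    rw [← hprod, hz, zero_mul]
  have hg0 : PowerSeries.constantCoeff g ≠ 0 := by
    intro hz
    apply hkg0
    rw [hz, PadicInt.coe_zero, mul_zero]
  have hh0 : PowerSeries.constantCoeff h ≠ 0 := by
    rw [← hkg, hkg']
    intro hz
    apply hkg0
    rw [← PadicInt.coe_mul, hz, PadicInt.coe_zero]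
  have hr0 : W.mordellWeilRank = 0 := by
    have hord : h.order ≤ 0 := PowerSeries.order_le 0 (by rwa [PowerSeries.coeff_zero_eq_constantCoeff])
    have h0' : (W.mordellWeilRank : ℕ∞) = 0 := nonpos_iff_eq_zero.mp (hrk.trans hord)
    exact_mod_cast h0'
  haveI : Finite W.toAffine.Point := W.mordellWeilRank_eq_zero_iff_finite.mp hr0
  -- THE height datum at the split prime IS the zero pairing in rank `0`; `Reg_p = 1`
  obtain ⟨Dh, hDh⟩ := exists_isSplitMultCanonical_of_finite W p Dq
  have hReg : padicRegulator Dh = 1 := padicRegulator_eq_one_of_finite W p Dh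
  have hSch : SchneiderConjecture Dh := by
    rw [SchneiderConjecture, hReg]
    exact one_ne_zero
  -- Stein–Wuthrich Thm. 6.1 (split): clause 2 gives `#Ш[p^∞] < ∞`, then clause 3 in rank `0`
  obtain ⟨-, h2, h3⟩ := hJ W p hp Dq κ γ hκ hγ hγ' D hX g hchar Dh hDh
  have hgord : g.order = (W.mordellWeilRank : ℕ∞) := by
    rw [hr0, Nat.cast_zero]
    exact nonpos_iff_eq_zero.mp (PowerSeries.order_le 0 (by rwa [PowerSeries.coeff_zero_eq_constantCoeff]))
  haveI hfinp : Finite (AddCommGroup.primaryComponent W.sha p) := (h2.mp hgord).2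
  obtain ⟨u, hu⟩ := h3 hSch hfinp
  simp only [hr0, zero_add, pow_one, hReg, mul_one, PowerSeries.coeff_zero_eq_constantCoeff] at hu
  set k0 : ℚ_[p] := ((PowerSeries.constantCoeff k : ℤ_[p]) : ℚ_[p]) with hk0_def
  have hk0v : 0 ≤ k0.valuation := PadicInt.valuation_coe_nonneg
  have htcast : ((t : ℚ) : ℚ_[p]) = (ϖ : ℚ_[p]) * (s : ℚ_[p]) := by
    rw [ht_def]; push_cast; ring
  -- the identity `t · #tors² = (u · k0) · #Ш[p^∞] · ∏ c_v`
  have key : (t : ℚ_[p]) * (W.torsionOrder : ℚ_[p]) ^ 2 =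
      (((u : ℤ_[p]) : ℚ_[p]) * k0) *
        (Nat.card (AddCommGroup.primaryComponent W.sha p) : ℚ_[p]) * (W.tamagawaProduct : ℚ_[p]) := by
    apply mul_left_cancel₀ h𝓛0
    rw [htcast, hk0_def]
    linear_combination (-(((ϖ : ℚ) : ℚ_[p]) * (W.torsionOrder : ℚ_[p]) ^ 2)) * hGS1 -
      (padicLog p (cyclotomicGenerator p) * (W.torsionOrder : ℚ_[p]) ^ 2) * h1 +
      ((PowerSeries.constantCoeff k : ℤ_[p]) : ℚ_[p]) * hu
  have hv : 0 ≤ (((u : ℤ_[p]) : ℚ_[p]) * k0).valuation := by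
    by_cases hk : k0 = 0
    · rw [hk, mul_zero, Padic.valuation_zero]
    · rw [Padic.valuation_mul (coe_units_ne_zero p u) hk, valuation_coe_units_eq_zero, zero_add]
      exact hk0v
  exact ⟨hr0, hfinp, t, hq, padicValNat_card_primary_le_of_torsionSq_mul_eq W p ht0 _ hv key⟩

end Summit.BirchSwinnertonDyer.Rank1Residual.X11b

end
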